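import Mathlib
import HarnessLib

/-!
# Crux `PrintCf2.SplitBadTwoRankOneOfFacts` (stmt-BirchSwinnertonDyer-20368), S3n′-FACT-FREE road, brick R1 file 2/3:
# an element of a number field all of whose valuations are divisible by `d` is, up to the class number, a unit times a
# `d`-th power: `x^h = ε · z^d`

Cell `bsd-print-cf2`, WIDTH seat `bsd-line-cf2-p1-w2` g14 (prover-bsd-line-cf2-p1-w2-g14-0); `--supports
stmt-BirchSwinnertonDyer-20368` (helper, Theses-free). HONEST FRAMING: nothing here closes the crux or a registered stub;
BSD is not proved by any of this; no summit statement is proved by this seat. No definition, no named fact, no `sorry`.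
Pure Mathlib (number field `F`, its ring of integers `𝓞 F`, the finite class group `ClassGroup (𝓞 F)`).

WHY (memo `Cruxes/SplitBadTwoRankOneOfFacts/S3N-FACTFREE-w2g14.md` §3, brick R1): the Kummer classes unramified outside
`v` are classes of `x ∈ F^×` with `p^M ∣ ord_w(x)` at every `w ∤ v`; to reach the UNITS (where Leopoldt acts) one clears
the ideal `(x) = 𝔞^{p^M}` with the class number `h`:

* §1 `finite_setOf_valuation_ne_one` (an element has finitely many non-trivial valuations);
  `exists_pow_classNumber_eq_span` (`w^h` is principal, `h = #Cl(F)`), and the valuations of its generator `π_w`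
  (`log_valuation_generator_self/_of_ne`: `−h` at `w`, `0` elsewhere).
* §2 **`exists_units_mul_pow_eq_pow_classNumber`**: for `x ≠ 0` with `d ∣ log v_w(x)` for EVERY finite place `w`
  (`d ≥ 1`), there are `ε ∈ (𝓞 F)^×` and `z ∈ F^×` with `x^h = ε · z^d` — `z := ∏_{w} π_w^{−log v_w(x)/d}`, and `x^h/z^d`
  has trivial valuation everywhere, hence is a unit of `𝓞 F` (`HeightOneSpectrum.mem_integers_of_valuation_le_one`).
beyond-print theorem: no (folklore). presearch: memo §5.

References: J. Neukirch, *Algebraic Number Theory* (1999), I §6 (class group finite), I (11.?) valuations of a Dedekind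
domain; folklore («`K(S, n)` is an extension of `Cl_S[n]` by `𝒪_S^×/n`», cf. Mathlib `RingTheory/DedekindDomain/SelmerGroup`).
-/

noncomputable section

set_option linter.dupNamespace false
set_option autoImplicit false

open scoped Classical
open NumberField IsDedekindDomain

namespace Summit.BirchSwinnertonDyer.BirchSwinnertonDyer.Theorems.PrintCf2.KummerProNull

universe u

variable {F : Type u} [Field F] [NumberField F]

/-! ## §1. Finitely many non-trivial valuations; principal powers of primes and their valuations -/

/-- A non-zero element of a number field has `v_w(x) = 1` for all but finitely many finite places `w`. [folklore] -/
theorem finite_setOf_valuation_ne_one {x : F} (hx : x ≠ 0) :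
    {w : HeightOneSpectrum (𝓞 F) | w.valuation F x ≠ 1}.Finite := by
  obtain ⟨a, b, hb, hab⟩ := IsFractionRing.div_surjective (A := 𝓞 F) x
  have hb0 : b ≠ 0 := nonZeroDivisors.ne_zero hb
  have ha0 : a ≠ 0 := by
    rintro rfl
    rw [map_zero, zero_div] at hab
    exact hx hab.symm
  have hfa := Ideal.finite_factors (I := Ideal.span {a}) (by simpa [Ideal.span_singleton_eq_bot] using ha0)
  have hfb := Ideal.finite_factors (I := Ideal.span {b}) (by simpa [Ideal.span_singleton_eq_bot] using hb0)
  refine (hfa.union hfb).subset fun w hw ↦ ?_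
  by_contra hmem
  simp only [Set.mem_union, Set.mem_setOf_eq, not_or] at hmem
  apply hw
  rw [← hab, map_div₀, HeightOneSpectrum.valuation_of_algebraMap, HeightOneSpectrum.valuation_of_algebraMap,
    HeightOneSpectrum.intValuation_eq_one_iff.mpr (fun h ↦ hmem.1 ((HeightOneSpectrum.intValuation_lt_one_iff_dvd w a).mp
      ((HeightOneSpectrum.intValuation_lt_one_iff_mem w a).mpr h))),
    HeightOneSpectrum.intValuation_eq_one_iff.mpr (fun h ↦ hmem.2 ((HeightOneSpectrum.intValuation_lt_one_iff_dvd w b).mp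
      ((HeightOneSpectrum.intValuation_lt_one_iff_mem w b).mpr h))), div_one]

/-- **`w^h` is principal**, `h = #Cl(𝓞 F)`: a generator `π_w ≠ 0` with `w^h = (π_w)`. [cite: NeukirchANT1999, I §6 (Thm. 6.3)] -/
theorem exists_pow_classNumber_eq_span (w : HeightOneSpectrum (𝓞 F)) :
    ∃ π : 𝓞 F, π ≠ 0 ∧ w.asIdeal ^ Fintype.card (ClassGroup (𝓞 F)) = Ideal.span {π} := by
  set h : ℕ := Fintype.card (ClassGroup (𝓞 F)) with hh
  have hne : w.asIdeal ^ h ≠ ⊥ := pow_ne_zero _ w.ne_bot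
  have hmem : w.asIdeal ^ h ∈ nonZeroDivisors (Ideal (𝓞 F)) := mem_nonZeroDivisors_of_ne_zero hne
  have hw : w.asIdeal ∈ nonZeroDivisors (Ideal (𝓞 F)) := mem_nonZeroDivisors_of_ne_zero w.ne_bot
  have hprin : Submodule.IsPrincipal (w.asIdeal ^ h) := by
    rw [← ClassGroup.mk0_eq_one_iff hmem]
    have : (⟨w.asIdeal ^ h, hmem⟩ : nonZeroDivisors (Ideal (𝓞 F))) = ⟨w.asIdeal, hw⟩ ^ h := by
      apply Subtype.ext; simp
    rw [this, map_pow, hh, pow_card_eq_one]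
  refine ⟨Submodule.IsPrincipal.generator (w.asIdeal ^ h), ?_, (Ideal.span_singleton_generator _).symm⟩
  intro h0
  apply hne
  rw [← Ideal.span_singleton_generator (w.asIdeal ^ h), h0, Ideal.span_singleton_eq_bot]

/-- The valuation of a generator of `w^h` at `w` is `exp(−h)`. [folklore] -/
theorem log_valuation_generator_self {w : HeightOneSpectrum (𝓞 F)} {π : 𝓞 F} {h : ℕ} (hπ0 : π ≠ 0)
    (hπ : w.asIdeal ^ h = Ideal.span {π}) : WithZero.log (w.valuation F (π : F)) = -(h : ℤ) := by
  rw [HeightOneSpectrum.valuation_of_algebraMap]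
  have hne : w.intValuation π ≠ 0 := HeightOneSpectrum.intValuation_ne_zero w π hπ0
  have hle : w.intValuation π ≤ WithZero.exp (-(h : ℤ)) := by
    rw [HeightOneSpectrum.intValuation_le_pow_iff_dvd, hπ]
  have hnlt : ¬ w.intValuation π ≤ WithZero.exp (-((h + 1 : ℕ) : ℤ)) := by
    rw [HeightOneSpectrum.intValuation_le_pow_iff_dvd, ← hπ, Ideal.dvd_iff_le]
    exact not_le_of_gt (Ideal.pow_succ_lt_pow w.ne_bot h)
  rw [← WithZero.exp_log hne, WithZero.exp_le_exp] at hle hnlt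
  push_cast at hnlt
  omega

/-- The valuation of a generator of `w^h` at another place `w' ≠ w` is `1`. [folklore] -/
theorem log_valuation_generator_of_ne {w w' : HeightOneSpectrum (𝓞 F)} {π : 𝓞 F} {h : ℕ}
    (hπ : w.asIdeal ^ h = Ideal.span {π}) (hne : w' ≠ w) : WithZero.log (w'.valuation F (π : F)) = 0 := by
  rw [HeightOneSpectrum.valuation_of_algebraMap]
  have h1 : w'.intValuation π = 1 := by
    rw [HeightOneSpectrum.intValuation_eq_one_iff]
    intro hmem
    have hle : w.asIdeal ^ h ≤ w'.asIdeal := by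
      rw [hπ, Ideal.span_singleton_le_iff_mem]
      exact hmem
    have hle' : w.asIdeal ≤ w'.asIdeal := Ideal.IsPrime.le_of_pow_le hle
    have hmax : w.asIdeal.IsMaximal := Ideal.IsPrime.isMaximal w.isPrime w.ne_bot
    exact hne (HeightOneSpectrum.ext (hmax.eq_of_le w'.isPrime.ne_top hle').symm)
  rw [h1, WithZero.log_one]

/-! ## §2. `x^h = ε · z^d` when every valuation of `x` is divisible by `d` -/

/-- **Up to the class number, an element with all valuations divisible by `d` is a unit times a `d`-th power.**
For `x ∈ F^×` with `d ∣ log v_w(x)` at every finite place `w` (`d ≥ 1`), there are `ε ∈ (𝓞 F)^×` and `z ∈ F^×` with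
`x^h = ε · z^d`, `h = #Cl(𝓞 F)`: with `e_w := log v_w(x)/d` and `π_w` a generator of `w^h`, put `z := ∏_w π_w^{−e_w}`
(finite product); then `x^h / z^d` has trivial valuation at every `w`, so it is a unit of `𝓞 F`.
[cite: NeukirchANT1999, I §6 (Thm. 6.3)] -/
theorem exists_units_mul_pow_eq_pow_classNumber {d : ℕ} (hd : 0 < d) {x : F} (hx : x ≠ 0)
    (hdiv : ∀ w : HeightOneSpectrum (𝓞 F), (d : ℤ) ∣ WithZero.log (w.valuation F x)) :
    ∃ (ε : (𝓞 F)ˣ) (z : F), z ≠ 0 ∧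
      x ^ Fintype.card (ClassGroup (𝓞 F)) = algebraMap (𝓞 F) F (ε : 𝓞 F) * z ^ d := by
  set h : ℕ := Fintype.card (ClassGroup (𝓞 F)) with hh
  -- generators `π_w` of `w^h`, exponents `e_w`
  choose π hπ0 hπ using fun w : HeightOneSpectrum (𝓞 F) ↦ exists_pow_classNumber_eq_span (F := F) w
  choose e he using hdiv
  have hπF : ∀ w, (π w : F) ≠ 0 := fun w ↦ by
    rw [Ne, NumberField.RingOfIntegers.coe_eq_zero_iff]; exact hπ0 w
  -- the finite support and `z`
  set S : Finset (HeightOneSpectrum (𝓞 F)) := (finite_setOf_valuation_ne_one hx).toFinset with hS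
  have hSmem : ∀ w, w ∈ S ↔ w.valuation F x ≠ 1 := fun w ↦ by
    rw [hS, Set.Finite.mem_toFinset, Set.mem_setOf_eq]
  have he0 : ∀ w, w ∉ S → e w = 0 := by
    intro w hw
    rw [hSmem, not_not] at hw
    have := he w
    rw [hw, WithZero.log_one] at this
    rcases mul_eq_zero.mp this.symm with h1 | h1
    · exact absurd h1 (by exact_mod_cast hd.ne')
    · exact h1
  set z : F := ∏ w ∈ S, (π w : F) ^ (-(e w)) with hz
  have hz0 : z ≠ 0 := Finset.prod_ne_zero_iff.mpr fun w _ ↦ zpow_ne_zero _ (hπF w)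
  -- valuations of `z`: `log v_{w'}(z) = h * e_{w'}`
  have hvalz : ∀ w' : HeightOneSpectrum (𝓞 F), WithZero.log (w'.valuation F z) = (h : ℤ) * e w' := by
    intro w'
    rw [hz, map_prod]
    have hlog : WithZero.log (∏ w ∈ S, w'.valuation F ((π w : F) ^ (-(e w)))) =
        ∑ w ∈ S, WithZero.log (w'.valuation F ((π w : F) ^ (-(e w)))) := by
      refine Finset.induction_on S (by simp) fun a s ha ih ↦ ?_
      rw [Finset.prod_insert ha, Finset.sum_insert ha, WithZero.log_mul, ih]
      · exact (Valuation.ne_zero_iff _).mpr (zpow_ne_zero _ (hπF a))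
      · exact Finset.prod_ne_zero_iff.mpr fun w _ ↦ (Valuation.ne_zero_iff _).mpr (zpow_ne_zero _ (hπF w))
    rw [hlog]
    have hterm : ∀ w, WithZero.log (w'.valuation F ((π w : F) ^ (-(e w)))) = if w = w' then (h : ℤ) * e w' else 0 := by
      intro w
      rw [map_zpow₀, WithZero.log_zpow]
      by_cases hww : w = w'
      · subst hww
        rw [if_pos rfl, log_valuation_generator_self (hπ0 w) (hπ w)]
        ring
      · rw [if_neg hww, log_valuation_generator_of_ne (hπ w) (Ne.symm hww), smul_zero]
    simp_rw [hterm]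
    rw [Finset.sum_ite_eq' S w']
    split_ifs with hw'
    · rfl
    · rw [he0 w' hw', mul_zero]
  -- the unit `u = x^h / z^d`
  set u : F := x ^ h / z ^ d with hu
  have hu0 : u ≠ 0 := div_ne_zero (pow_ne_zero _ hx) (pow_ne_zero _ hz0)
  have hvalu : ∀ w : HeightOneSpectrum (𝓞 F), w.valuation F u = 1 := by
    intro w
    have hne : w.valuation F u ≠ 0 := (Valuation.ne_zero_iff _).mpr hu0
    have hlog : WithZero.log (w.valuation F u) = 0 := by
      rw [hu, map_div₀, map_pow, map_pow, WithZero.log_div, WithZero.log_pow, WithZero.log_pow, hvalz w, he w]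
      · ring
      · exact pow_ne_zero _ ((Valuation.ne_zero_iff _).mpr hx)
      · exact pow_ne_zero _ ((Valuation.ne_zero_iff _).mpr hz0)
    rw [← WithZero.exp_log hne, hlog]
    rfl
  obtain ⟨a, ha⟩ := HeightOneSpectrum.mem_integers_of_valuation_le_one F u fun w ↦ (hvalu w).le
  obtain ⟨b, hb⟩ := HeightOneSpectrum.mem_integers_of_valuation_le_one F u⁻¹
    fun w : HeightOneSpectrum (𝓞 F) ↦ by rw [map_inv₀, hvalu, inv_one]
  have hab : a * b = 1 := by
    apply NumberField.RingOfIntegers.coe_injective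
    rw [map_mul, map_one, ha, hb, mul_inv_cancel₀ hu0]
  refine ⟨Units.mkOfMulEqOne a b hab, z, hz0, ?_⟩
  rw [Units.val_mkOfMulEqOne, ha, hu, div_mul_cancel₀ _ (pow_ne_zero _ hz0)]

end Summit.BirchSwinnertonDyer.BirchSwinnertonDyer.Theorems.PrintCf2.KummerProNull

end
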